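import Summits.Ventures.PercRepro.RankLevelSetHallReservoir

/-!
# PercRepro — (♠′) FROM A TOURNAMENT OF REPAIRS: the general injection rule behind the reservoir theorem (night-1, gen 15;
dossier §26.5)

RankLevelSetHallReservoir repairs every rank-`q` superset `S` of a member by adjoining a `(p − #S)`-subset of ONE global
reservoir.  THIS FILE isolates the collision analysis: any assignment `S ↦ W S` of repair sets works as long as
(i) `W S ⊆ E`, `#(W S) = p − #S`, (ii) no element of `W S` lies in `cl S` (`r(insert w S) ≠ q`), and (iii) for every two sets
`S₁, S₂` of ℛ, one of them keeps its repair set out of the closure of the other (a **tournament**: `W S₁ ∩ cl S₂ = ∅` or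
`W S₂ ∩ cl S₁ = ∅`).  Then `φ(S) = S ∪ W S` is (♠′): if `S₁ ∪ W S₁ = S₂ ∪ W S₂` and, say, `W S₁` avoids `cl S₂`, then `S₂ ⊆ S₁`
(an element of `S₂ ∩ W S₁` would lie in `cl S₂`), and then every `x ∈ S₁ ∖ S₂` lies in `W S₂` with `insert x S₂ ⊆ S₁` of rank
`q` — against (ii); so `S₁ = S₂`.  The reservoir theorem is the case `W S ⊆ G` (then (iii) holds with both disjuncts); census
(night-1 g15, own exact code tournament.py, dossier §26.5): on the 9-element catalogue at (6,3) the reservoir condition covers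
981 of the 1,203 loopless tight-layer matroids, a tournament 137 more (92.9 %), and the remaining 85 (26 simple) have (♠′) by
an explicit perfect matching that no tournament realises — the cyclic repairs of §26.5.

* **`spadeInjection_of_repair`** — (i)–(iii) ⇒ `SpadeInjection M p q` at `#E = p + q`;
* **`hallUp_of_ncard_eq_of_repair`** — hence the UP-Hall condition of C-044 for every family of members;
* `spadeInjection_of_reservoir'` — the reservoir theorem re-derived as the case `W S ⊆ G`.
Axioms: standard.
-/

namespace PercRepro

open Set Matroid

variable {α : Type} (M : Matroid α) [M.Finite]

/-- **(♠′) FROM A TOURNAMENT OF REPAIRS** (`#E = p + q`): repair sets `W S ⊆ E` of size `p − #S` outside `cl S`, such that for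
every two sets of ℛ one keeps its repair set out of the closure of the other — then `S ↦ S ∪ W S` is the injection (♠′). -/
theorem spadeInjection_of_repair (p q : ℕ) (hE : M.E.ncard = p + q) (W : Set α → Set α)
    (hWE : ∀ S ∈ rankqOver M p q, W S ⊆ M.E) (hWcard : ∀ S ∈ rankqOver M p q, (W S).ncard = p - S.ncard)
    (hWcl : ∀ S ∈ rankqOver M p q, ∀ w ∈ W S, M.eRk (insert w S) ≠ (q : ℕ∞))
    (htour : ∀ S₁ ∈ rankqOver M p q, ∀ S₂ ∈ rankqOver M p q,
      (∀ w ∈ W S₁, M.eRk (insert w S₂) ≠ (q : ℕ∞)) ∨ (∀ w ∈ W S₂, M.eRk (insert w S₁) ≠ (q : ℕ∞))) :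
    SpadeInjection M p q := by
  classical
  have hEfin : M.E.Finite := M.set_finite M.E
  -- the one-sided step: if `W S₁` avoids `cl S₂` and `S₁ ∪ W S₁ = S₂ ∪ W S₂`, then `S₁ = S₂`
  have key : ∀ S₁ ∈ rankqOver M p q, ∀ S₂ ∈ rankqOver M p q,
      S₁ ∪ W S₁ = S₂ ∪ W S₂ → (∀ w ∈ W S₁, M.eRk (insert w S₂) ≠ (q : ℕ∞)) → S₁ = S₂ := by
    intro S₁ hS₁ S₂ hS₂ hEq havoid
    -- `S₂ ⊆ S₁`
    have h21 : S₂ ⊆ S₁ := by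
      intro x hx
      have hx' : x ∈ S₁ ∪ W S₁ := by
        rw [hEq]
        exact Or.inl hx
      rcases hx' with hx1 | hxW
      · exact hx1
      · exfalso
        apply havoid x hxW
        rw [Set.insert_eq_of_mem hx]
        exact hS₂.2.1
    -- `S₁ ⊆ S₂`: an element of `S₁ ∖ S₂` lies in `W S₂`, but `insert x S₂ ⊆ S₁` has rank `q`
    have h12 : S₁ ⊆ S₂ := by
      intro x hx
      by_contra hxS₂
      have hx' : x ∈ S₂ ∪ W S₂ := by
        rw [← hEq]
        exact Or.inl hx
      rcases hx' with hx2 | hxW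
      · exact hxS₂ hx2
      · apply hWcl S₂ hS₂ x hxW
        apply le_antisymm
        · calc M.eRk (insert x S₂) ≤ M.eRk S₁ := M.eRk_mono (Set.insert_subset hx h21)
            _ = (q : ℕ∞) := hS₁.2.1
        · rw [← hS₂.2.1]
          exact M.eRk_mono (Set.subset_insert x S₂)
    exact Set.Subset.antisymm h12 h21
  refine ⟨fun S => S ∪ W S, ?_, ?_⟩
  · intro S₁ hS₁ S₂ hS₂ hEq
    simp only at hEq
    rcases htour S₁ hS₁ S₂ hS₂ with h | h
    · exact key S₁ hS₁ S₂ hS₂ hEq h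
    · exact (key S₂ hS₂ S₁ hS₁ hEq.symm h).symm
  · intro S hS
    obtain ⟨hSE, hrS, hlo, hhi, -⟩ := id hS
    have hWS := hWE S hS
    have hWc := hWcard S hS
    have hSfin : S.Finite := hEfin.subset hSE
    have hWfin : (W S).Finite := hEfin.subset hWS
    have hdisj : Disjoint S (W S) := by
      rw [Set.disjoint_left]
      intro x hxS hxW
      apply hWcl S hS x hxW
      rw [Set.insert_eq_of_mem hxS]
      exact hrS
    have hTcard : (S ∪ W S).ncard = p := by
      rw [Set.ncard_union_eq hdisj hSfin hWfin, hWc]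
      omega
    have hWne : (W S).Nonempty := by
      rw [← Set.ncard_pos hWfin, hWc]
      omega
    obtain ⟨w, hw⟩ := hWne
    refine ⟨⟨union_subset hSE hWS, ?_, ?_, ?_⟩, subset_union_left⟩
    · -- rank above `q` through `insert w S`
      have h1 : (q : ℕ∞) ≤ M.eRk (insert w S) := by
        rw [← hrS]
        exact M.eRk_mono (Set.subset_insert w S)
      calc (q : ℕ∞) < M.eRk (insert w S) := lt_of_le_of_ne h1 (Ne.symm (hWcl S hS w hw))
        _ ≤ M.eRk (S ∪ W S) := by
          apply M.eRk_mono
          intro x hx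
          rcases hx with rfl | hxS
          · exact Or.inr hw
          · exact Or.inl hxS
    · -- rank below `p`
      calc M.eRk (S ∪ W S) ≤ M.eRk S + M.eRk (W S) := M.eRk_union_le_eRk_add_eRk _ _
        _ ≤ M.eRk S + (W S).encard := add_le_add_right (M.eRk_le_encard _) _
        _ = ((q + (p - S.ncard) : ℕ) : ℕ∞) := by
          rw [hrS, ← hWfin.cast_ncard_eq, hWc]
          push_cast
          rfl
        _ < (p : ℕ∞) := by exact_mod_cast (show q + (p - S.ncard) < p by omega)
    · rw [hTcard]

/-- **C-044, UP FORM, AT THE TIGHT LAYER FROM A TOURNAMENT OF REPAIRS**: the hypotheses of `spadeInjection_of_repair` give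
the UP-Hall condition for every family of members. -/
theorem hallUp_of_ncard_eq_of_repair (p q : ℕ) (hE : M.E.ncard = p + q) (W : Set α → Set α)
    (hWE : ∀ S ∈ rankqOver M p q, W S ⊆ M.E) (hWcard : ∀ S ∈ rankqOver M p q, (W S).ncard = p - S.ncard)
    (hWcl : ∀ S ∈ rankqOver M p q, ∀ w ∈ W S, M.eRk (insert w S) ≠ (q : ℕ∞))
    (htour : ∀ S₁ ∈ rankqOver M p q, ∀ S₂ ∈ rankqOver M p q,
      (∀ w ∈ W S₁, M.eRk (insert w S₂) ≠ (q : ℕ∞)) ∨ (∀ w ∈ W S₂, M.eRk (insert w S₁) ≠ (q : ℕ∞)))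
    (𝒜 : Set (Set α)) (h𝒜 : 𝒜 ⊆ cellMembers M p q) :
    phiK p q * (𝒜.ncard : ℚ) ≤ ((upNbhd M p q 𝒜).ncard : ℚ) :=
  hallUp_of_ncard_eq_of_spade M p q hE (spadeInjection_of_repair M p q hE W hWE hWcard hWcl htour) 𝒜 h𝒜

/-- The reservoir theorem re-derived: repair sets inside the reservoir satisfy (ii) and both halves of (iii). -/
theorem spadeInjection_of_reservoir' (p q : ℕ) (hE : M.E.ncard = p + q)
    (hG : p - q - 1 ≤ (spadeReservoir M p q).ncard) : SpadeInjection M p q := by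
  classical
  have hW : ∀ j : ℕ, j ≤ (spadeReservoir M p q).ncard → ∃ W : Set α, W ⊆ spadeReservoir M p q ∧ W.ncard = j :=
    fun j hj => Set.exists_subset_card_eq hj
  choose! W hW using hW
  have hj : ∀ S ∈ rankqOver M p q, p - S.ncard ≤ (spadeReservoir M p q).ncard := by
    intro S hS
    have := hS.2.2.1
    omega
  refine spadeInjection_of_repair M p q hE (fun S => W (p - S.ncard)) ?_ ?_ ?_ ?_
  · intro S hS
    exact ((hW _ (hj S hS)).1).trans (fun e he => he.1)
  · intro S hS
    exact (hW _ (hj S hS)).2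
  · intro S hS w hw
    exact ((hW _ (hj S hS)).1 hw).2 S hS
  · intro S₁ hS₁ S₂ hS₂
    left
    intro w hw
    exact ((hW _ (hj S₁ hS₁)).1 hw).2 S₂ hS₂

end PercRepro
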